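import Literature.AnabelianGeometry.SemiGraphs.TemperedInductionFibrewise
import Literature.AnabelianGeometry.SemiGraphs.TemperoidsResProofs
import Literature.AlgebraicGeometry.Frobenioids.QuasiTemperoidInduction
import HarnessLib

/-!
# [SemiAnbd] Prop. 3.6 (v), fibrewise layer (2): `B^temp(Π)_S ≌ ∏_{ω} B^temp(Stab s_ω)`

Mochizuki, *Semi-graphs of anabelioids*, Publ. RIMS **42** (2006) 221–322, §3, Proposition 3.6 (v),
manuscript p. 39 [cite: MochizukiSemiAnbd2006, Prop 3.6(v) p.39] ("`B^temp(G') → B^temp(G)` is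
étale", i.e. `B^temp(G') ≃ B^temp(G)_S` for the tempered covering `G' → G` given by `S`), single
constituent anabelioid: the vertex of `G'` over `v` attached to the orbit `ω` of `S_v` carries the
anabelioid of the STABILISER of a point of `ω` (§2 p. 23, §3 p. 37).  Proof-only sequel (no
definitions) of `TemperedInductionFibrewise` (`B^temp(Π)_S ≌ ∏_ω B^temp(Π)_{S_ω}`): for `Π`
tempered,

* `BTemp.nonempty_cosetObj_iso_orbitPart` — an orbit `S_ω` with a chosen point `s` is the coset
  object `Π/Stab(s)`;
* `BTemp.nonempty_over_orbitPart_equiv` — hence `B^temp(Π)_{S_ω} ≌ B^temp(Π)_{Π/Stab(s)} ≌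
  B^temp(Stab(s))`, the last step being [FrdII] Ex. 1.3 (i) (`InductionEquivalence`, the tree's
  `QuasiTemperoid.inductionEquivalence_holds`);
* `BTemp.nonempty_over_equiv_pi_stab` — assembling over the orbits (choice of a point in each):
  `B^temp(Π)_S ≌ ∏_{ω} B^temp(Stab(s_ω))`.

abc-iut G10 ladder, item Prop 3.6 (v) (`EtaleOfTemperedCovering`), statement-independent layer
(L3-lead 20:45:33Z).  No statement of the paper is strengthened.
-/

open CategoryTheory Topology

namespace Literature.AnabelianGeometry.SemiGraphs

open Literature.AlgebraicGeometry.Frobenioids.QuasiTemperoid.BTempConnected (hom_ρ hom_ext_apply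
  ρ_one_apply ρ_mul_apply ρ_inv_apply)
open Literature.AlgebraicGeometry.Frobenioids (QuasiTemperoid.cosetObj)

universe u

namespace BTemp

variable {G : Type u} [Group G] [TopologicalSpace G]

/-- The stabiliser of a point of an object of `B^temp(Π)` is open. [cite: MochizukiSemiAnbd2006, §3 p.33] -/
theorem isOpen_stab (S : BTemp G) (s : S.obj.V) : IsOpen (BTemp.stab S s : Set G) :=
  S.property.2 s

variable [IsTopologicalGroup G]

/-- **An orbit is a coset object**: for `Π` tempered and `s ∈ S`, `g Stab(s) ↦ g · s` is an
isomorphism `Π/Stab(s) ≅ S_{[s]}` in `B^temp(Π)`. [cite: MochizukiSemiAnbd2006, Rmk 3.1.2 p.33] -/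
theorem nonempty_cosetObj_iso_orbitPart (hG : IsTempered G) (S : BTemp G) (s : S.obj.V) :
    Nonempty (QuasiTemperoid.cosetObj G hG (BTemp.stab S s) (isOpen_stab S s) ≅
      orbitPart S (cl S s)) := by
  classical
  -- the map `g Stab(s) ↦ g · s`
  let f : G ⧸ BTemp.stab S s → OrbitPts S (cl S s) :=
    Quotient.lift (fun g : G => (⟨S.obj.ρ g s, cl_ρ S g s⟩ : OrbitPts S (cl S s)))
      (fun a b hab => by
        apply Subtype.ext
        change S.obj.ρ a s = S.obj.ρ b s
        have h : a⁻¹ * b ∈ BTemp.stab S s := QuotientGroup.leftRel_apply.mp hab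
        have h' : S.obj.ρ (a⁻¹ * b) s = s := h
        rw [ρ_mul_apply] at h'
        have := congrArg (S.obj.ρ a) h'
        rw [← ρ_mul_apply, mul_inv_cancel, ρ_one_apply] at this
        exact this.symm)
  have hf : ∀ g : G, f (g : G ⧸ BTemp.stab S s) = ⟨S.obj.ρ g s, cl_ρ S g s⟩ := fun g => rfl
  let φ : QuasiTemperoid.cosetObj G hG (BTemp.stab S s) (isOpen_stab S s) ⟶ orbitPart S (cl S s) :=
    ObjectProperty.homMk
      { hom := TypeCat.ofHom f
        comm := fun g => by
          apply ConcreteCategory.hom_ext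
          intro q
          obtain ⟨a, rfl⟩ := QuotientGroup.mk_surjective q
          change f (g • (a : G ⧸ BTemp.stab S s)) = (orbitPart S (cl S s)).obj.ρ g (f a)
          rw [MulAction.Quotient.smul_mk, smul_eq_mul, hf, hf]
          apply Subtype.ext
          exact ρ_mul_apply S g a s }
  refine ⟨isoOfBijective φ ⟨?_, ?_⟩⟩
  · intro q q' hqq'
    obtain ⟨a, rfl⟩ := QuotientGroup.mk_surjective q
    obtain ⟨b, rfl⟩ := QuotientGroup.mk_surjective q'
    have h : S.obj.ρ a s = S.obj.ρ b s := congrArg Subtype.val hqq'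
    apply Quotient.sound
    apply QuotientGroup.leftRel_apply.mpr
    change S.obj.ρ (a⁻¹ * b) s = s
    rw [ρ_mul_apply, ← h, ρ_inv_apply]
  · rintro ⟨t, ht⟩
    obtain ⟨g, hg⟩ := (cl_eq_cl_iff S s t).mp ht.symm
    exact ⟨(g : G ⧸ BTemp.stab S s), Subtype.ext hg⟩

/-- **Induction, one orbit**: for `Π` tempered and a point `s` of the orbit `ω` of `S`,
`B^temp(Π)_{S_ω} ≌ B^temp(Stab(s))` (via `S_ω ≅ Π/Stab(s)` and [FrdII] Ex. 1.3 (i)).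
[cite: MochizukiSemiAnbd2006, Prop 3.6(v) p.39] -/
theorem nonempty_over_orbitPart_equiv (hG : IsTempered G) (S : BTemp G) (ω : Orbits S) (s : S.obj.V)
    (hs : cl S s = ω) :
    Nonempty (Over (orbitPart S ω) ≌ BTemp (BTemp.stab S s)) := by
  subst hs
  obtain ⟨e⟩ := nonempty_cosetObj_iso_orbitPart hG S s
  obtain ⟨ind⟩ := Literature.AlgebraicGeometry.Frobenioids.QuasiTemperoid.inductionEquivalence_holds
    G hG (BTemp.stab S s) (isOpen_stab S s)
  exact ⟨(Over.mapIso e.symm).trans ind.symm⟩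

/-- **The fibrewise layer of Prop. 3.6 (v)**: for `Π` tempered and `S ∈ B^temp(Π)`, choosing a point
`s_ω` in every orbit, `B^temp(Π)_S ≌ ∏_{ω} B^temp(Stab(s_ω))` — the category of tempered coverings of
`G` over `S`, restricted to one constituent anabelioid `B(Π_v)`, is the product over the vertices of
`G'` above `v` of the `B^temp` of their groups. [cite: MochizukiSemiAnbd2006, Prop 3.6(v) p.39] -/
theorem nonempty_over_equiv_pi_stab (hG : IsTempered G) (S : BTemp G) :
    Nonempty (Over S ≌ ∀ ω : Orbits S, BTemp (BTemp.stab S (Quot.out ω))) :=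
  ⟨(overEquivPiOver S).trans (Equivalence.pi fun ω =>
    (nonempty_over_orbitPart_equiv hG S ω (Quot.out ω) (Quot.out_eq ω)).some)⟩

end BTemp

end Literature.AnabelianGeometry.SemiGraphs
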